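import Mathlib
import Summits.ResolutionOfSingularities.ResolutionOfSingularities.Theorems.IndSmoothValuativeSmoothingFibrewiseCriterion
import Summits.ResolutionOfSingularities.ResolutionOfSingularities.Theorems.IndSmoothValuativeSmoothingDevissageStep
import Summits.ResolutionOfSingularities.ResolutionOfSingularities.Theorems.IndSmoothValuativeSmoothingAdjoinLeOverring
import Summits.ResolutionOfSingularities.ResolutionOfSingularities.Theorems.IndSmoothValuativeSmoothingChainIndependence
import Summits.ResolutionOfSingularities.ResolutionOfSingularities.Theorems.IndSmoothValuativeSmoothingResidueIndependence
import Summits.ResolutionOfSingularities.ResolutionOfSingularities.Theorems.IndSmoothValuativeSmoothingSpecialFibre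
import Summits.ResolutionOfSingularities.ResolutionOfSingularities.Theorems.IndSmoothValuativeSmoothingTopLevel
import Literature.AlgebraicGeometry.Resolution.SmoothFactorizationsTransport
import Literature.AlgebraicGeometry.Resolution.CompositeValuations
import HarnessLib

/-!
# Valuation rings with all jumps discrete are ind-smooth (crux `IndSmooth.ValuativeSmoothing`,
# line `birth`, lead c1: assembly of the devissage programme "discrete jumps")

Crux stmt-ResolutionOfSingularities-16087 (`IndSmooth.ValuativeSmoothing`): valuation rings `O`
of function fields `K/k` over a PERFECT field `k` of characteristic `p` are ind-smooth over `k`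
(every finitely generated `k`-subalgebra `R ⊆ O` factors into `O` through a smooth `k`-algebra).
This file PROVES it — unconditionally, and for ANY field `K ⊇ k`, finitely generated or not —
for the valuation rings whose value group has ALL JUMPS DISCRETE, presented by a chain
`O = O₀ ≤ O₁ ≤ ⋯ ≤ O_N = K` of valuation subrings with `𝔪_{O_i} = e_i O_i` principal and
`O_{i+1} = O_i[1/e_i]` (`Γ_O ≅ ℤ^N` lexicographically). This family contains non-Noetherian,
non-Abhyankar valuation rings (e.g. rank `2`, `Γ = ℤ²`, residue field algebraic over `k`,
`trdeg K/k = 3`), which the reshape r3 of the line had inside the open kernel.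

Mechanism (Popescu slicing with ind-smooth fibres, no local uniformization, no Temkin):
descending induction on the level `j`, over the IMPERFECT base fields
`F_j = k(e_0, …, e_{j-1}) ⊆ O_j`. The top level `O_N = K` is ind-smooth over `F_N`
(`hasSmoothFactorizations_of_valuation_of_eq_top`: Mac Lane separability from the valuation
independence of the `e_i` modulo `p`-th powers, `valuation_monomial_ne_of_chain`); the step
`j+1 ↦ j` is the one-element slicing `hasSmoothFactorizations_devissage_step` (Stacks 07F5 re-run
for the Noetherian base `F_j[X]` and the flat non-Noetherian `O_j`,
`hasSmoothFactorizations_of_flat_of_fibre`), whose special fibre `κ(O_j)` is ind-smooth over `F_j`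
(`hasSmoothFactorizations_residueField_of_valuation`, fed by `valuation_monomial_ne_residue`)
and whose generic fibre is the level `j+1`; at `j = 0`, `F_0 = k`.

* `hasSmoothFactorizations_of_discreteChain` — `HasSmoothFactorizations k (Os 0)` (tree's PT).
* `smoothFactor_of_discreteChain` — the crux's conclusion verbatim for every finitely generated
  `R ⊆ Os 0`.
-/

noncomputable section

-- single-problem summit: the doubled namespace component is forced
set_option linter.dupNamespace false

open IsLocalRing
open Literature.AlgebraicGeometry.Resolution

namespace Summit.ResolutionOfSingularities.ResolutionOfSingularities.Theorems.ValuativeSmoothing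

/-! ### Generators and base fields of the levels

No definitions are introduced (they would be review-queued): the family of generators below
level `j : Fin (N + 1)` is written `fun t : Fin (Fin.val j) => e (Fin.castLE _ t)` and the base
field `F_j = k(e_0, …, e_{j-1})` is `IntermediateField.adjoin k (Set.range <that family>)`. -/

section Generators

variable {K : Type} {N : ℕ} (e : Fin N → K)

/-- The generators below level `i + 1` are those below level `i` together with `e i`. -/
theorem range_gen_succ (i : Fin N) :
    Set.range (fun t : Fin (Fin.val i.succ) => e (Fin.castLE (Nat.le_of_lt_succ (Fin.isLt i.succ))
        t)) = Set.range (fun t : Fin (Fin.val i.castSucc) => e (Fin.castLE (Nat.le_of_lt_succ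
        (Fin.isLt i.castSucc)) t)) ∪ {e i} := by
  ext x
  simp only [Set.mem_range, Set.union_singleton, Set.mem_insert_iff]
  constructor
  · rintro ⟨m, rfl⟩
    have hm2 : (m : ℕ) < (i : ℕ) + 1 := by
      have := m.2
      simpa only [Fin.val_succ] using this
    by_cases hm : (m : ℕ) < i
    · refine Or.inr ⟨⟨m, by simpa only [Fin.val_castSucc] using hm⟩, ?_⟩
      congr 1
    · left
      have hmi : (m : ℕ) = i := by omega
      congr 1
      exact Fin.ext hmi
  · rintro (rfl | ⟨m, rfl⟩)
    · exact ⟨⟨i, by simp only [Fin.val_succ]; omega⟩, by congr 1⟩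
    · have hm2 : (m : ℕ) < (i : ℕ) := by
        have := m.2
        simpa only [Fin.val_castSucc] using this
      exact ⟨⟨m, by simp only [Fin.val_succ]; omega⟩, by congr 1⟩

end Generators

section Fields

variable {K : Type} [Field K] {N : ℕ} (e : Fin N → K) (k : Type) [Field k] [Algebra k K]

/-- At level `0` the base field is `k`. -/
theorem fld_zero : IntermediateField.adjoin k (Set.range (fun t : Fin (Fin.val (0 : Fin (N + 1)))
    => e (Fin.castLE (Nat.le_of_lt_succ (Fin.isLt (0 : Fin (N + 1)))) t))) = ⊥ := by
  have : IsEmpty (Fin ((0 : Fin (N + 1)) : ℕ)) := by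
    rw [Fin.val_zero]
    infer_instance
  rw [show Set.range (fun t : Fin (Fin.val (0 : Fin (N + 1))) => e (Fin.castLE (Nat.le_of_lt_succ
      (Fin.isLt (0 : Fin (N + 1)))) t)) = ∅ from Set.range_eq_empty _,
    IntermediateField.adjoin_empty]

/-- Passing to the next level adjoins the generator `e i`. -/
theorem fld_succ (i : Fin N) :
    IntermediateField.adjoin k (Set.range (fun t : Fin (Fin.val i.succ) => e (Fin.castLE
        (Nat.le_of_lt_succ (Fin.isLt i.succ)) t))) = IntermediateField.adjoin k (Set.range (fun t :
        Fin (Fin.val i.castSucc) => e (Fin.castLE (Nat.le_of_lt_succ (Fin.isLt i.castSucc)) t))) ⊔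
        IntermediateField.adjoin k {e i} := by
  rw [range_gen_succ, IntermediateField.adjoin_union]

end Fields


section Main

variable (k K : Type) [Field k] [Field K]
  [Algebra k K] (N : ℕ) (Os : Fin (N + 1) → ValuationSubring K) (e : Fin N → K)
  (he : ∀ i : Fin N, e i ∈ Os i.castSucc) (he0 : ∀ i : Fin N, e i ≠ 0)
  (hmax : ∀ i : Fin N,
    IsLocalRing.maximalIdeal (Os i.castSucc) = Ideal.span {(⟨e i, he i⟩ : Os i.castSucc)})
  (hloc : ∀ (i : Fin N) (x : K), x ∈ Os i.succ ↔ ∃ n : ℕ, e i ^ n * x ∈ Os i.castSucc)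
  (htop : Os (Fin.last N) = ⊤) (hk : ∀ c : k, algebraMap k K c ∈ Os 0)

include hloc in
/-- The chain of valuation subrings is monotone. -/
theorem chain_mono : Monotone Os := ChainIndependence.chain_monotone N Os e hloc

include he0 hmax hloc hk in
/-- `F_j ⊆ O_j` for every level `j`. -/
theorem fld_le : ∀ (j : Fin (N + 1)) (x : K), x ∈ IntermediateField.adjoin k (Set.range (fun t :
    Fin (Fin.val j) => e (Fin.castLE (Nat.le_of_lt_succ (Fin.isLt j)) t))) → x ∈ Os j := by
  intro j
  induction j using Fin.induction with
  | zero =>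
    intro x hx
    rw [fld_zero e k] at hx
    obtain ⟨c, rfl⟩ := IntermediateField.mem_bot.mp hx
    exact hk c
  | succ i ih =>
    intro x hx
    rw [fld_succ e k] at hx
    exact adjoin_le_overring_of_maximalIdeal_eq k K (Os i.castSucc) (Os i.succ) (e i) (he i)
      (he0 i) (hmax i) (hloc i) (IntermediateField.adjoin k (Set.range (fun t : Fin (Fin.val
          i.castSucc) => e (Fin.castLE (Nat.le_of_lt_succ (Fin.isLt i.castSucc)) t)))) ih x hx

include he0 hmax hloc in
/-- The independence of the generators below level `j` modulo `p`-th powers, with respect to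
the finest valuation ring `Os 0`. -/
theorem hind_gen (p : ℕ) [Fact p.Prime] (j : Fin (N + 1)) (α β : Fin j → Fin p) (hαβ : α ≠ β)
    (h : K) :
    (Os 0).valuation (∏ i, (fun t : Fin (Fin.val j) => e (Fin.castLE (Nat.le_of_lt_succ (Fin.isLt
        j)) t)) i ^ (α i : ℕ)) ≠
      (Os 0).valuation (h ^ p * ∏ i, (fun t : Fin (Fin.val j) => e (Fin.castLE (Nat.le_of_lt_succ
          (Fin.isLt j)) t)) i ^ (β i : ℕ)) := by
  classical
  -- extend the exponent vectors by zero
  let ext : (Fin j → Fin p) → Fin N → Fin p := fun γ m =>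
    if hm : (m : ℕ) < j then γ ⟨m, hm⟩ else ⟨0, (Fact.out : p.Prime).pos⟩
  have hprod : ∀ γ : Fin j → Fin p,
      ∏ m, e m ^ (ext γ m : ℕ) = ∏ i, (fun t : Fin (Fin.val j) => e (Fin.castLE (Nat.le_of_lt_succ
          (Fin.isLt j)) t)) i ^ (γ i : ℕ) := by
    intro γ
    -- the product over `Fin N` restricted to the image of `Fin.castLE`
    have hj : (j : ℕ) ≤ N := Nat.le_of_lt_succ j.2
    rw [← Finset.prod_subset (Finset.subset_univ ((Finset.univ : Finset (Fin j)).map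
      (Fin.castLEEmb hj)))]
    · rw [Finset.prod_map]
      refine Finset.prod_congr rfl fun i _ => ?_
      simp [ext, Fin.castLEEmb]
    · intro m _ hm
      have hm' : ¬ (m : ℕ) < j := by
        intro hlt
        apply hm
        simp only [Finset.mem_map, Finset.mem_univ, true_and]
        exact ⟨⟨m, hlt⟩, Fin.ext rfl⟩
      simp [ext, hm']
  have hne : ext α ≠ ext β := by
    intro hext
    apply hαβ
    funext i
    have := congr_fun hext (Fin.castLE (Nat.le_of_lt_succ j.2) i)
    simpa [ext] using this
  have := valuation_monomial_ne_of_chain p K N Os e he he0 hmax hloc (ext α) (ext β) hne h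
  rwa [hprod, hprod] at this

include he0 hmax hloc htop hk in
/-- **PT at every level**: `O_j` is ind-smooth over `F_j = k(e_0, …, e_{j-1})`, by descending
induction on `j`. -/
theorem hasSmoothFactorizations_level (p : ℕ) [Fact p.Prime] [CharP k p] [PerfectField k]
    (j : Fin (N + 1)) :
    letI : Algebra (IntermediateField.adjoin k (Set.range (fun t : Fin (Fin.val j) => e (Fin.castLE
        (Nat.le_of_lt_succ (Fin.isLt j)) t)))) (Os j) :=
      ((algebraMap (IntermediateField.adjoin k (Set.range (fun t : Fin (Fin.val j) => e (Fin.castLE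
          (Nat.le_of_lt_succ (Fin.isLt j)) t)))) K).codRestrict (Os j).toSubring
        (fun c => fld_le k K N Os e he he0 hmax hloc hk j c c.2)).toAlgebra
    HasSmoothFactorizations (IntermediateField.adjoin k (Set.range (fun t : Fin (Fin.val j) => e
        (Fin.castLE (Nat.le_of_lt_succ (Fin.isLt j)) t)))) (Os j) := by
  classical
  induction j using Fin.reverseInduction with
  | last =>
    letI : Algebra (IntermediateField.adjoin k (Set.range (fun t : Fin (Fin.val (Fin.last N)) => e
        (Fin.castLE (Nat.le_of_lt_succ (Fin.isLt (Fin.last N))) t)))) (Os (Fin.last N)) :=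
      ((algebraMap (IntermediateField.adjoin k (Set.range (fun t : Fin (Fin.val (Fin.last N)) => e
          (Fin.castLE (Nat.le_of_lt_succ (Fin.isLt (Fin.last N))) t)))) K).codRestrict (Os
          (Fin.last N)).toSubring
        (fun c => fld_le k K N Os e he he0 hmax hloc hk (Fin.last N) c c.2)).toAlgebra
    haveI : IsScalarTower (IntermediateField.adjoin k (Set.range (fun t : Fin (Fin.val (Fin.last
        N)) => e (Fin.castLE (Nat.le_of_lt_succ (Fin.isLt (Fin.last N))) t)))) (Os (Fin.last N)) K
        :=
      IsScalarTower.of_algebraMap_eq fun _ => rfl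
    have hO : ∀ x : K, x ∈ Os (Fin.last N) := fun x => by rw [htop]; trivial
    exact hasSmoothFactorizations_of_valuation_of_eq_top p k K (Os 0) (Os (Fin.last N)) hO
      ((fun t : Fin (Fin.val (Fin.last N)) => e (Fin.castLE (Nat.le_of_lt_succ (Fin.isLt (Fin.last
          N))) t))) (hind_gen K N Os e he he0 hmax hloc p (Fin.last N))
  | cast i ih =>
    -- the data of the step
    letI iO : Algebra (IntermediateField.adjoin k (Set.range (fun t : Fin (Fin.val i.castSucc) => e
        (Fin.castLE (Nat.le_of_lt_succ (Fin.isLt i.castSucc)) t)))) (Os i.castSucc) :=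
      ((algebraMap (IntermediateField.adjoin k (Set.range (fun t : Fin (Fin.val i.castSucc) => e
          (Fin.castLE (Nat.le_of_lt_succ (Fin.isLt i.castSucc)) t)))) K).codRestrict (Os
          i.castSucc).toSubring
        (fun c => fld_le k K N Os e he he0 hmax hloc hk i.castSucc c c.2)).toAlgebra
    haveI : IsScalarTower (IntermediateField.adjoin k (Set.range (fun t : Fin (Fin.val i.castSucc)
        => e (Fin.castLE (Nat.le_of_lt_succ (Fin.isLt i.castSucc)) t)))) (Os i.castSucc) K :=
      IsScalarTower.of_algebraMap_eq fun _ => rfl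
    letI iO' : Algebra (IntermediateField.adjoin k (Set.range (fun t : Fin (Fin.val i.succ) => e
        (Fin.castLE (Nat.le_of_lt_succ (Fin.isLt i.succ)) t)))) (Os i.succ) :=
      ((algebraMap (IntermediateField.adjoin k (Set.range (fun t : Fin (Fin.val i.succ) => e
          (Fin.castLE (Nat.le_of_lt_succ (Fin.isLt i.succ)) t)))) K).codRestrict (Os
          i.succ).toSubring
        (fun c => fld_le k K N Os e he he0 hmax hloc hk i.succ c c.2)).toAlgebra
    haveI : IsScalarTower (IntermediateField.adjoin k (Set.range (fun t : Fin (Fin.val i.succ) => e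
        (Fin.castLE (Nat.le_of_lt_succ (Fin.isLt i.succ)) t)))) (Os i.succ) K :=
      IsScalarTower.of_algebraMap_eq fun _ => rfl
    letI iR : Algebra (IntermediateField.adjoin k (Set.range (fun t : Fin (Fin.val i.castSucc) => e
        (Fin.castLE (Nat.le_of_lt_succ (Fin.isLt i.castSucc)) t)))) (ResidueField (Os i.castSucc))
        :=
      ((residue (Os i.castSucc)).comp
        (algebraMap (IntermediateField.adjoin k (Set.range (fun t : Fin (Fin.val i.castSucc) => e
            (Fin.castLE (Nat.le_of_lt_succ (Fin.isLt i.castSucc)) t)))) (Os i.castSucc))).toAlgebra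
    haveI : IsScalarTower (IntermediateField.adjoin k (Set.range (fun t : Fin (Fin.val i.castSucc)
        => e (Fin.castLE (Nat.le_of_lt_succ (Fin.isLt i.castSucc)) t)))) (Os i.castSucc)
        (ResidueField (Os i.castSucc)) :=
      IsScalarTower.of_algebraMap_eq fun _ => rfl
    have hmono := chain_mono K N Os e hloc
    have hle0 : Os 0 ≤ Os i.castSucc := hmono (Fin.zero_le _)
    -- the special fibre
    have hjN : ((i.castSucc : Fin (N + 1)) : ℕ) ≤ N := Nat.le_of_lt_succ i.castSucc.2
    have hlt : ∀ m : Fin (i.castSucc : ℕ), ((Fin.castLE hjN m : Fin N) : ℕ) < (i : ℕ) := by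
      intro m
      have := m.2
      simpa only [Fin.val_castLE, Fin.val_castSucc] using this
    have ha : ∀ m : Fin (i.castSucc : ℕ), (fun t : Fin (Fin.val i.castSucc) => e (Fin.castLE
        (Nat.le_of_lt_succ (Fin.isLt i.castSucc)) t)) m ∈ Os i.castSucc := by
      intro m
      refine hmono ?_ (he (Fin.castLE hjN m))
      change ((Fin.castLE hjN m : Fin N) : ℕ) ≤ ((i.castSucc : Fin (N + 1)) : ℕ)
      have h1 := hlt m
      have h2 : ((i.castSucc : Fin (N + 1)) : ℕ) = i := Fin.val_castSucc i
      omega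
    have hai : ∀ m : Fin (i.castSucc : ℕ), ((fun t : Fin (Fin.val i.castSucc) => e (Fin.castLE
        (Nat.le_of_lt_succ (Fin.isLt i.castSucc)) t)) m)⁻¹ ∈ Os i.castSucc := by
      intro m
      have hm : (Fin.castLE hjN m : Fin N).succ ≤ i.castSucc := by
        change ((Fin.castLE hjN m : Fin N) : ℕ) + 1 ≤ ((i.castSucc : Fin (N + 1)) : ℕ)
        have h1 := hlt m
        have h2 : ((i.castSucc : Fin (N + 1)) : ℕ) = i := Fin.val_castSucc i
        omega
      refine hmono hm ((hloc _ _).mpr ⟨1, ?_⟩)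
      rw [pow_one, mul_inv_cancel₀ (he0 _)]
      exact (Os _).one_mem
    have h1 : HasSmoothFactorizations (IntermediateField.adjoin k (Set.range (fun t : Fin (Fin.val
        i.castSucc) => e (Fin.castLE (Nat.le_of_lt_succ (Fin.isLt i.castSucc)) t)))) (ResidueField
        (Os i.castSucc)) :=
      hasSmoothFactorizations_residueField_of_valuation p k K (Os 0) (Os i.castSucc) hle0
        (fun c => hle0 (hk c)) ((fun t : Fin (Fin.val i.castSucc) => e (Fin.castLE
            (Nat.le_of_lt_succ (Fin.isLt i.castSucc)) t))) ha
        (fun α β hαβ h => valuation_monomial_ne_residue p K (Os 0) (Os i.castSucc) hle0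
          ((fun t : Fin (Fin.val i.castSucc) => e (Fin.castLE (Nat.le_of_lt_succ (Fin.isLt
              i.castSucc)) t))) ha hai (hind_gen K N Os e he he0 hmax hloc p i.castSucc) α β hαβ h)
    -- the generic fibre = the induction hypothesis; the step
    exact hasSmoothFactorizations_devissage_step
      (fun R Λ _ _ _ _ _ hfib => hasSmoothFactorizations_of_flat_of_fibre R Λ hfib)
      k K (Os i.castSucc) (Os i.succ) (hmono i.castSucc_lt_succ.le) (e i) (he i) (he0 i)
      (hmax i) (hloc i) (IntermediateField.adjoin k (Set.range (fun t : Fin (Fin.val i.castSucc) =>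
          e (Fin.castLE (Nat.le_of_lt_succ (Fin.isLt i.castSucc)) t)))) (IntermediateField.adjoin k
          (Set.range (fun t : Fin (Fin.val i.succ) => e (Fin.castLE (Nat.le_of_lt_succ (Fin.isLt
          i.succ)) t))))
      (fld_le k K N Os e he he0 hmax hloc hk i.castSucc) (fld_succ e k i) h1 ih

include he0 hmax hloc htop in
/-- **Valuation rings with all jumps discrete are ind-smooth over the perfect ground field**:
`HasSmoothFactorizations k (Os 0)` for the `k`-algebra structure given by `k ⊆ Os 0`. -/
theorem hasSmoothFactorizations_of_discreteChain (p : ℕ) [Fact p.Prime] [CharP k p]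
    [PerfectField k] :
    letI : Algebra k (Os 0) := ((algebraMap k K).codRestrict (Os 0).toSubring hk).toAlgebra
    HasSmoothFactorizations k (Os 0) := by
  letI ik : Algebra k (Os 0) := ((algebraMap k K).codRestrict (Os 0).toSubring hk).toAlgebra
  letI i0 : Algebra (IntermediateField.adjoin k (Set.range (fun t : Fin (Fin.val (0 : Fin (N + 1)))
      => e (Fin.castLE (Nat.le_of_lt_succ (Fin.isLt (0 : Fin (N + 1)))) t)))) (Os 0) :=
    ((algebraMap (IntermediateField.adjoin k (Set.range (fun t : Fin (Fin.val (0 : Fin (N + 1))) =>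
        e (Fin.castLE (Nat.le_of_lt_succ (Fin.isLt (0 : Fin (N + 1)))) t)))) K).codRestrict (Os
        0).toSubring
      (fun c => fld_le k K N Os e he he0 hmax hloc hk 0 c c.2)).toAlgebra
  have h0 := hasSmoothFactorizations_level k K N Os e he he0 hmax hloc htop hk p 0
  -- transport the base `F_0 = ⊥ ≅ k`
  let eq0 : IntermediateField.adjoin k (Set.range (fun t : Fin (Fin.val (0 : Fin (N + 1))) => e
      (Fin.castLE (Nat.le_of_lt_succ (Fin.isLt (0 : Fin (N + 1)))) t))) ≃ₐ[k] (⊥ :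
      IntermediateField k K) :=
    IntermediateField.equivOfEq (fld_zero e k)
  let eR : IntermediateField.adjoin k (Set.range (fun t : Fin (Fin.val (0 : Fin (N + 1))) => e
      (Fin.castLE (Nat.le_of_lt_succ (Fin.isLt (0 : Fin (N + 1)))) t))) ≃+* k :=
    (eq0.trans (IntermediateField.botEquiv k K)).toRingEquiv
  refine HasSmoothFactorizations.of_ringEquiv_base eR (fun r => ?_) h0
  apply Subtype.ext
  change algebraMap k K (eR r) = (r : K)
  have hr : (r : K) ∈ (⊥ : IntermediateField k K) := by rw [← fld_zero e k]; exact r.2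
  obtain ⟨c, hc⟩ := IntermediateField.mem_bot.mp hr
  have hrc : r = algebraMap k (IntermediateField.adjoin k (Set.range (fun t : Fin (Fin.val (0 : Fin
      (N + 1))) => e (Fin.castLE (Nat.le_of_lt_succ (Fin.isLt (0 : Fin (N + 1)))) t)))) c := by
    apply Subtype.ext
    rw [← hc]
    rfl
  rw [hrc]
  change algebraMap k K ((IntermediateField.botEquiv k K) (eq0 (algebraMap k _ c))) = _
  rw [AlgEquiv.commutes, IntermediateField.botEquiv_def]
  rfl

include he0 hmax hloc htop hk in
/-- **The crux `IndSmooth.ValuativeSmoothing` for valuation rings with all jumps discrete**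
(any field `K ⊇ k`, `k` perfect of characteristic `p`): every finitely generated `k`-subalgebra
`R ⊆ O = Os 0` factors `R → T → O` through a SMOOTH `k`-algebra `T`, the composite being the
inclusion — the conclusion of the crux verbatim. -/
theorem smoothFactor_of_discreteChain (p : ℕ) [Fact p.Prime] [CharP k p] [PerfectField k]
    (R : Subalgebra k K) (hR : R.FG) (hRO : R.toSubring ≤ (Os 0).toSubring) :
    ∃ (T : Type) (_ : CommRing T) (_ : Algebra k T), Algebra.Smooth k T ∧
      ∃ (ψ : R →ₐ[k] T) (χ : T →ₐ[k] K), (∀ t : T, χ t ∈ Os 0) ∧ ∀ r : R, χ (ψ r) = (r : K) := by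
  letI ik : Algebra k (Os 0) := ((algebraMap k K).codRestrict (Os 0).toSubring hk).toAlgebra
  haveI : IsScalarTower k (Os 0) K := IsScalarTower.of_algebraMap_eq fun _ => rfl
  have hPT : HasSmoothFactorizations k (Os 0) :=
    hasSmoothFactorizations_of_discreteChain k K N Os e he he0 hmax hloc htop hk p
  -- the inclusion `R → Os 0` as a `k`-algebra map
  let φ : R →ₐ[k] Os 0 :=
    { toFun := fun r => ⟨r, hRO r.2⟩
      map_one' := rfl
      map_mul' := fun _ _ => rfl
      map_zero' := rfl
      map_add' := fun _ _ => rfl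
      commutes' := fun _ => rfl }
  haveI : Algebra.FiniteType k R := by
    rw [← R.fg_iff_finiteType]
    exact hR
  obtain ⟨C, _, _, hC, v, w, hvw⟩ := hPT R inferInstance φ
  refine ⟨C, inferInstance, inferInstance, hC, v, (IsScalarTower.toAlgHom k (Os 0) K).comp w,
    fun t => (w t).2, fun r => ?_⟩
  change ((w (v r) : Os 0) : K) = r
  rw [← AlgHom.comp_apply, hvw]
  rfl

end Main

/-- **Valuation rings with all jumps discrete are ind-smooth** — the crux
`IndSmooth.ValuativeSmoothing` (stmt-ResolutionOfSingularities-16087) for this family, all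
hypotheses explicit (registered support stub of line `birth`, lead c1): `k` perfect of
characteristic `p`, `K ⊇ k` ANY field, `O = Os 0` the bottom of a chain
`Os 0 ≤ ⋯ ≤ Os N = ⊤` of valuation subrings of `K` with `𝔪(Os i) = (e i)` and
`Os (i+1) = (Os i)[1/e i]`; then every finitely generated `k`-subalgebra `R ⊆ O` factors into `O`
through a smooth `k`-algebra. No local uniformization, no resolution, no Temkin: Popescu
slicing with ind-smooth fibres (`hasSmoothFactorizations_of_flat_of_fibre`) and Mac Lane
separability from the valuation. [folklore] -/
theorem smoothFactor_of_discreteJumps (p : ℕ) [Fact p.Prime] (k K : Type) [Field k] [CharP k p]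
    [PerfectField k] [Field K] [Algebra k K] (N : ℕ) (Os : Fin (N + 1) → ValuationSubring K)
    (e : Fin N → K) (he : ∀ i : Fin N, e i ∈ Os i.castSucc) (he0 : ∀ i : Fin N, e i ≠ 0)
    (hmax : ∀ i : Fin N,
      IsLocalRing.maximalIdeal (Os i.castSucc) = Ideal.span {(⟨e i, he i⟩ : Os i.castSucc)})
    (hloc : ∀ (i : Fin N) (x : K), x ∈ Os i.succ ↔ ∃ n : ℕ, e i ^ n * x ∈ Os i.castSucc)
    (htop : Os (Fin.last N) = ⊤) (hk : ∀ c : k, algebraMap k K c ∈ Os 0)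
    (R : Subalgebra k K) (hR : R.FG) (hRO : R.toSubring ≤ (Os 0).toSubring) :
    ∃ (T : Type) (_ : CommRing T) (_ : Algebra k T), Algebra.Smooth k T ∧
      ∃ (ψ : R →ₐ[k] T) (χ : T →ₐ[k] K), (∀ t : T, χ t ∈ Os 0) ∧ ∀ r : R, χ (ψ r) = (r : K) :=
  smoothFactor_of_discreteChain k K N Os e he he0 hmax hloc htop hk p R hR hRO

end Summit.ResolutionOfSingularities.ResolutionOfSingularities.Theorems.ValuativeSmoothing

end
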